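import Summits.ABC.ABC.Theorems.EllipticGluingPrimeBound.Negative.LoadBearing

/-!
# Disproof of `EllipticGluingPrimeBound` (crux U, stmt-ABC-13919) — findings

Standing-adversary work file (refuter `cdisprove`, cycle 1, 2026-08-16). VERDICT SO FAR: **no kill**;
the statement is a genuine open problem of (semi-uniform) Frey–Mazur type. The Lean content of §0–§2
has LANDED in the tree as `Summits/ABC/ABC/Theorems/EllipticGluingPrimeBound/Negative/LoadBearing.lean`
(p84292, accepted 2026-08-16T06:27Z; namespace `Summit.ABC.ABC.Theorems.EllipticGluingPrimeBound.Negative`)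
and is IMPORTED here (re-checked by `example`s); this file adds the neighbourhood map (§4) and keeps
the prose analysis. `sorry`-free; paper-only facts are `def … : Prop` with status in the docstring.

## 0. The statement, read back (W.lean, rc 0, `rfl`)

`U := ∃ κ C : ℝ, 0 ≤ κ ∧ Bound κ C` (`iff_exists_bound`), where `Bound κ C` says: for every elliptic
`W/ℚ`, every abelian-variety model `E` of `W` (`e : E(ℚ̄) ≃+ W(ℚ̄)` `Γ_ℚ`-equivariant), every
abelian variety `B/ℚ` and every prime `ℓ`, IF some non-zero `E`-multiplier of `B` exists
(`α ≫ β = n • 𝟙 E`, `n ≠ 0`) AND `ℓ` divides every multiplier, THEN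
`ℓ ≤ C · (dim B · max 1 h_F(W)) ^ κ`. All carriers are REAL definitions (no interface junk):
`AbelianVariety` = proper geometrically-integral `ℚ`-group scheme, `Hom` = group-scheme homs
(preadditive, `n • 𝟙` = `[n]`), `dim` = topological Krull dimension (junk `0` only for `∅`/`∞`-dim,
impossible here), `stableFaltingsHeight` = closed Silverman formula. Normalisation PROVED here:
`U ↔ ∃ κ C, 1 ≤ κ ∧ 0 ≤ C ∧ Bound κ C` (`iff_normalised`; uses that an instance with a non-zero
multiplier has `dim B ≠ 0`, `dim_ne_zero_of_multiplier`).

## 1. Load-bearing analysis (section §2 below; all PROVED, witnesses in Lean)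

* `n ≠ 0` in the existence hypothesis is load-bearing: `ellipticGluingPrimeBound_false_without_neZero`
  (witness: `B = zeroAbelianVariety`, the point `Spec ℚ` with the trivial group law, a genuine
  abelian variety of `dim 0` built here; all its `E`-multipliers are `0`, because `End E` is
  torsion-free — `zsmul_id_eq_zero_iff`, proved from `#W[n] = n²`).
* the `∀`-divisibility hypothesis is load-bearing and cannot be weakened to "`ℓ` divides SOME
  non-zero multiplier": `ellipticGluingPrimeBound_false_without_forallDvd`, `not_existsForm`
  (witness: `B = E`, multiplier `ℓ = (ℓ • 𝟙) ≫ 𝟙` for every prime `ℓ`).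
* the degenerate instances are already excluded by the hypotheses as filed: `B = E`
  (`not_forall_dvd_self`: `1` is a multiplier), `dim B = 0` (`not_exists_multiplier_of_dim_eq_zero`).
* `dim B` in the bound is load-bearing and `κ ≥ 1` is forced — modulo the paper family H_Res
  (`WeilRestrictionFamily`: `B_ℓ = Res_{K_ℓ/ℚ} W`, `K_ℓ/ℚ` cyclic of prime degree `ℓ`, multipliers
  `= ℓℤ`, `dim B_ℓ = ℓ`; not constructible in the tree — no Weil restriction of schemes):
  `not_withoutDim_of_weilRestrictionFamily`, `one_le_kappa_of_weilRestrictionFamily` (both PROVED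
  from H_Res; the real-analysis half is unconditional).
* NOT shown load-bearing (information for the prover): the equivariance of `e` and even `max 1 h_F(W)`
  — dropping the height gives the UNIFORM torsion-sharing bound `ℓ ≤ C (dim B)^κ`, which for
  bounded `dim B` is PREDICTED TRUE by the uniform Frey–Mazur / Darmon conjectures (d = 1: no
  `ℓ > 17` known, CremonaFreitas2021) and is open; no counterexample to it is known either.

## 2. Structural reduction (paper; agrees with refuter-rattack note 2026-08-15)

For `ℓ > 163` (beyond Mazur–Kenku rational isogenies) and `E[ℓ]` absolutely irreducible
(non-CM: Serre + Bilu–Parent–Rebolledo, image `GL₂` or `⊂ N(C_ns)` but never `⊂ C_ns` since complex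
conjugation has `det = -1`; CM: `Ind_K^ℚ χ̄_ℓ` irreducible once `χ̄_ℓ ≠ χ̄_ℓ^c`): write
`B ⊇ X + A` with `X ~ E^m` the `E`-isotypic abelian subvariety and `Hom(E, A) = 0`. Galois-stable
finite subgroups of `X` of `ℓ`-power order are lattice-shaped (`Λ/ℤ_ℓ^m ⊗ T_ℓ E`, Nakayama from
`End_{𝔽_ℓ[Γ]}(E[ℓ]) = 𝔽_ℓ`), so `X/G ≅ E^m` again and the ideal of multipliers of `E` in any
`Y ~ E^m` is prime to `ℓ`. HENCE: `ℓ ∣` every multiplier ⟺ the gluing subgroup `X ∩ A` contains a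
copy of `E[ℓ]`, i.e. `E[ℓ] ↪ A(ℚ̄)` `Γ_ℚ`-equivariantly with `Hom(E, A) = 0`. So
**U ⟺ the partner-height-free torsion-sharing bound over ALL partners `A`** (not only GL₂-type):
`E[ℓ] ↪ A[ℓ], Hom(E,A) = 0 ⟹ ℓ ≤ C'(dim A · max 1 h(E))^κ'`. Any proof of U proves that; any
disproof is a torsion-sharing family with `log ℓ / log(dim A · h(E)) → ∞`.

## 3. Counterexample hunt — families tried, why each fails (envelope: `ℓ ≤ 2 dim B + O(1)`)

* F1 Weil restrictions `Res_{K/ℚ} E_K`: multipliers `∋ [K:ℚ]`-part only, `ℓ ∣ [K:ℚ] ≤ dim B`.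
  Gives exactly `κ ≥ 1` (tight family for the exponent, see §1).
* F2 Artin twists `M ⊗ E` (MazurRubinSilverberg2007): `ℓ` must divide `|G|`, `G ⊂ GL_r(ℤ)` (or
  `GL_r(O_K)` for CM) has an element of order `ℓ` only if `φ(ℓ) ≤ 2r`: `ℓ ≤ 2 dim B + 1`.
  The MULTIPLIER form (least positive multiplier `≤ C(dim·h)^κ`) IS false here (planner, rev 4:
  `M ⊂ ℤ ⊕ ⊕ᵢ ℤ[ζ_{pᵢ}]` glued along augmentations, least multiplier `∏ pᵢ = exp(c√(dim log dim))`;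
  re-derived: `M^G = (∏pᵢ)ℤ`, `Hom_G(M, ℤ) = ℤ·pr₁`) — which is WHY the crux is prime-by-prime.
* F3 rational cyclic isogenies `B = E/C`: `ℓ ≤ 163` (Mazur1978, Kenku) — absorbed by `C`.
* F4 no partner (`B ~ E^m`): impossible for `ℓ > 163` by §2.
* F5 **CM `W` with (potentially) CM partners — NEW this cycle, closes the CM flank:** if `W` has CM
  by `K` and `A/L` is CM with `χ̄_ℓ|_{G_L} ⊂ A[ℓ]^{ss}` then comparing the mod-`ℓ` inertia types
  (algebraic Hecke characters: at `v ∣ ℓ` the reduction on `I_v` is `θ_f^{-Σ n_τ ℓ^{a_τ}}`; for `ℓ`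
  unramified in `K` each residue class of embeddings lies in ONE fibre over `K`) forces the CM type
  of `A` to be induced from `K`, i.e. `A` is geometrically `W`-isotypic — a twist, so F2 applies:
  `ℓ ≤ 2 dim + 1`. (Checked by hand on `K = ℚ(i)`, `L = ℚ(i, √-ℓ)`, `ℓ ≡ 3 (4)`: exponents `2` vs
  `1 + ℓ` on `I_v`, no congruence.) So for CM `W` a kill needs a NON-CM partner whose mod-`ℓ` image
  is inside a Cartan normaliser: `d = 1` = rational points on `X_ns^+(ℓ)` (Serre uniformity, open;
  `X_s^+(ℓ)` empty for `ℓ ≥ 11`, Bilu–Parent–Rebolledo + BDMTV for 13), `d = [K':ℚ]` = non-CM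
  `K'`-curves with a `K'`-rational `ℓ`-isogeny of CM isogeny character (LarsonVaintrob2013 =
  doi:10.1017/s1474748013000182: finitely many `ℓ` under GRH; Banwait–Derickx explicit; split Cartan
  over `ℚ`: BiluParentRebolledo2013 = doi:10.5802/aif.2781). Conjecturally empty, not constructible.
* F6 non-CM `W` fixed, partners of bounded dimension and UNBOUNDED height (the semi-uniformity
  loophole named by the planner): `d = 1` = `ℚ`-points on `X_W(ℓ)` (Frey–Mazur). PRINT (read this
  cycle): Fisher, arXiv:2106.02033 §1: non-trivial `p`-congruences exist in infinite families for all
  `p ≤ 13`; exactly TWO sporadic pairs are known at `p = 17` — anti-symplectic `3675` ~ `47775`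
  (Cremona; `y²+xy = x³-8x+27` vs `y²+xy = x³+8124402x-11887136703`) and symplectic
  `279809270` ~ `3077901970` — and his Conjecture 1.1: for `p ≥ 17` every `p`-congruence over `ℚ` is
  explained by an isogeny or is a simultaneous quadratic twist of one of these two pairs. That is the
  `d = 1` slice of exactly what a kill of U needs to violate (CremonaFreitas2021 = doi:10.4171/rmi/1269
  for the symplectic-type methods; KaniSchanz1998 = doi:10.1007/pl00004379: the surfaces `Z(n,ε)` are of
  general type for `n ≥ 13`). `d = 2` = RM/QM
  surfaces or `Res` of quadratic points on `X_W(ℓ)` (gonality `≫ ℓ²`: finitely many per `ℓ`,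
  nothing known `≥ 19`); level raising at `k` primes `qᵢ` gives `ℓ ≲ min qᵢ ≲ (12 dim/N)^{1/k}` —
  LINEAR in `dim`, harmless; the partner of SMALL orbit at a LARGE prime is the only enemy.
  COMPUTE (this cycle; kit jobs j014237, j014238, PARI `mfsplit`/`mflinear`, congruence tested on all
  `a_p`, `p ≤ 300`, `p ∤` level; item evidence SCAN-REPORT.md): (a) level-raising partners of dimension
  `≤ 3` of twelve base curves `11a1 … 43a1`, complete for levels `N_E·m ≤ 966`: largest primes `ℓ = 17`
  (`20a1` vs a `d = 3` orbit at level `860`, `K_g = ℚ(ζ₉)⁺`) and `ℓ = 13`; (b) ALL pairs (rational newform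
  of level `M' ∣ M`) × (orbit of dimension `2, 3` at level `M`), levels `M ≤ 2000` (odd `M` complete to
  `855`): `ℓ = 11: 86`, `13: 42`, `17: 11`, `19: 7`, `23: 1` hits — e.g. `ℓ = 23` between an elliptic curve
  of conductor `1776` and a `d = 3` orbit at the same level, `ℓ = 19` between `38`-curves / `722`-curves
  and `d = 3` orbits at levels `494`, `722`. So with partners of dimension `2–3` the `d = 1` record `17` is
  ALREADY exceeded at levels `≤ 2000` (re-verified independently with full splitting, job j016382, and by
  hand for `ℓ = 23`: `λ = (23, y - 14)` in `ℚ[y]/(y³-y²-3y+1)`, `a_p(g) ≡ a_p(f)` for `p = 5, …, 19`). Calibration only: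
  `ℓ = 23`, `dim B = 4`, `h = O(1)` forces `C·4^κ ≥ 23`.
* F10 NORM / EULER-FACTOR-MIMICRY CONSTRAINT (paper, elementary, NEW; explains F6's data and bounds what
  computation can ever show). If `E[ℓ] ↪ A[ℓ]` for `A/ℚ` of dimension `d`, then at every prime `p ∤ ℓ`
  of good reduction `P_{E,p} = x² - a_p x + p` divides `P_{A,p}` modulo `ℓ`, so `ℓ ∣ Res(P_{A,p}, P_{E,p})`
  with `|Res| ≤ (4p)^{2d}`; for a GL₂-type partner `A_g`, `[K_g:ℚ] = d`, `Res = p^d·Nm(a_p(g) - a_p(E))²`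
  with `|Nm| ≤ (4√p)^d`. Hence EITHER `ℓ ≤ (4p)^{2d}` (resp. `ℓ^{f_λ} ≤ (4√p)^d`) OR `P_{E,p} ∣ P_{A,p}`
  exactly (resp. `a_p(g) = a_p(E) ∈ ℤ`). A torsion-sharing partner at prime `ℓ` therefore MIMICS the
  Euler factors of `E` at every good `p < ℓ^{1/(2d)}/4` (resp. has RATIONAL INTEGER eigenvalues
  `a_p(g) = a_p(E)` at every `p < ℓ^{2/d}/16` prime to its level). Consequences: (i) for `d = 1` this is the
  familiar "equal `a_p` for `p < ℓ²/16`"; (ii) for bounded `d` and `ℓ → ∞` a modular partner must have level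
  divisible by every prime `< ℓ^{2/d}/16` at which `a_p(g) ∉ ℤ` — density one of them absent inner twists
  — i.e. level `≥ exp(c ℓ^{2/d})`: the planner's kill route (i) ("bounded-dimensional level-raising
  partners of a fixed curve at unbounded primes") lives at astronomically large levels and can never be
  exhibited by computation, which only sees the unconstrained regime `ℓ ≲ (16 p₀)^{d/2}` (`p₀` = least
  prime not dividing the level) — exactly where the scan found `19, 23`; (iii) by Faltings, mimicry at ALL
  `p` would force `Hom(E, A) ≠ 0`, and effective versions (isogeny estimates) turn "mimicry up to
  `p ~ ℓ^{1/(2d)}`" into `ℓ ≤ poly_d(h(E), h(A))` — this is precisely how the partner's height enters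
  Masser–Wüstholz/Gaudron–Rémond, and why removing it (U) needs an input saying a bounded-dimensional `A`
  of huge height cannot mimic a small `E` for that long.
* F7 `W` varying with `h(W) = O(log ℓ)`: U already dies if `ℓ_k → ∞` with `ℓ_k ≥ N_{W_k}^δ` along
  torsion-sharing pairs of bounded partner dimension — again nothing beyond `ℓ = 17` exists in
  print or tables (Cremona–Freitas to conductor 500000).
* F8 (pointer left unverified by refuter-rattack; my reading, print check pending — searchd down this
  cycle): Darmon's Frey hyperelliptic Jacobians `J_r^±(t)` (Duke Math. J. 102 (2000), §1–2) have RM by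
  `ℚ(ζ_r)⁺`, `dim = (r-1)/2`, and at the prime `𝔯 ∣ r` their mod-`𝔯` representation is the mod-`r`
  representation of a Legendre/Frey elliptic curve `E_t`: a NON-twist torsion-sharing family with
  `ℓ = r = 2 dim + 1` for every prime `r` and fixed `h(E_t)` — again exactly `κ ≥ 1`, nothing more.
* CYCLOTOMIC COST (the unifying reason F1, F2, F5, F8 all stop at `ℓ ≤ 2 dim B + 1`): every known
  mechanism producing torsion-sharing at ARBITRARILY LARGE primes routes `ℓ` through `μ_ℓ`
  (`ζ_ℓ ≡ 1 mod (1 - ζ_ℓ)`): an order-`ℓ` automorphism of the twisting lattice, RM/CM through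
  `ℚ(ζ_ℓ)⁺ ⊂ End⁰`, or a Hecke character of `ℓ`-power order — and `μ_ℓ` acting faithfully costs
  `[ℚ(ζ_ℓ)⁺:ℚ] = (ℓ-1)/2 ≤ dim`. U with `κ = 1` is consistent with all of them. A kill must therefore be
  NON-cyclotomic ("sporadic") torsion sharing at large primes in bounded dimension — precisely the
  configurations the uniform Frey–Mazur / Darmon conjectures forbid and isogeny estimates cannot yet
  exclude without the partner's height. This is the sharpest statement of why U resists disproof AND
  why its proof is out of reach of MasserWustholz/GaudronRemond-type transcendence alone.
* F9 GENERIC (non-cyclotomic) partners exist for EVERY `E` and EVERY prime `ℓ`, at polynomial cost: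
  a point of the twisted modular curve `X_E(ℓ)` in the `j`-fibre over any rational `j₀` (not in the
  isogeny class of `E`) is an `E'/L` with `E'[ℓ] ≅ E[ℓ]|_{G_L}`, `[L:ℚ] ≤ |PSL₂(𝔽_ℓ)| < ℓ³/2`; then
  `A = Res_{L/ℚ} E'` has `Hom(E, A) = Hom_L(E, E') = 0`, `E[ℓ] ↪ A[ℓ]` (Frobenius reciprocity +
  irreducibility of `E[ℓ]`), and `B = (E × A)/graph` has multipliers `= ℓℤ` (§2, ⟸: `Hom(E,B) = ℤ·ι`,
  `Hom(B,E)` factors through `B/A = E/E[ℓ]`), `dim B ≤ ℓ³/2 + 1`, partner height ARBITRARY. So the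
  height-free loophole is real but only buys `ℓ ≈ (2 dim B)^{1/3}` generically (`κ ≥ 1/3` from a
  non-cyclotomic mechanism; F1 already gives `κ ≥ 1`). INDEX PRINCIPLE behind F1–F9: whenever the
  sharing of `E[ℓ]` is explained inside `ℚ(E[ℓ], A[ℓ])` by group theory — the two structures agree
  only over a field `L ≠ ℚ` — the cost is `dim A ≥ [L:ℚ] ≥` (minimal index of a proper subgroup of
  `PSL₂(𝔽_ℓ)`) `= ℓ + 1` (`ℓ > 11`), or `(ℓ-1)/2` through `μ_ℓ ⊂ End`. A kill needs the sharing to be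
  defined over `ℚ` itself with `dim A = ℓ^{o(1)}`: sporadic large congruences, none known `> 17`.
* Instance (i) calibration (`B = J₀(N)`): `ℓ ∣ m_E`, `dim ≈ N/12`, `h ≈ (log N)/12`: prime factors of
  modular degrees as large as `N^{1.2…1.5}` occur (Watkins), so the TRUE `κ` (if any) is `> 1`;
  U only needs SOME absolute `κ`, so this is calibration, not danger, unless `log ℓ_max(m_E)/log N`
  drifts upward in tables (kill criterion (iii) of the route) — second half of the compute scan.

## 4. What a prover can take from here

* WLOG `κ ≥ 1`, `C ≥ 0` (`iff_normalised`) and WLOG `ℓ > L₀` for any fixed `L₀` (`iff_boundAbove`,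
  e.g. `L₀ = 163`); the case `dim B = 0` is vacuous; `B = E` is excluded.
* The hypotheses pin the problem to §2's torsion-sharing form; the partner's height is genuinely
  absent, so any isogeny-estimate proof must be uniform in `h(A)` for fixed `dim A` — i.e. must
  contain uniform Frey–Mazur for `d = 1` as the special case `A = E'`. That special case alone is
  open (Frey1997 Conj. 5 is the `h`-dependent form). This is the honest measure of U's difficulty.

## Index of declarations (landed in Negative/LoadBearing.lean unless marked HERE)

§0 `Bound`, `iff_exists_bound`, `bound_mono_C`, `bound_mono_κ`, `iff_normalised`, `BoundAbove`,
   `iff_boundAbove` (WLOG `ℓ > L₀`);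
§1 `geomPointsMap_zsmul_id`, `zsmul_id_eq_zero_iff`, `zsmul_multiplier`, `not_forall_dvd_self`,
   `zeroAbelianVariety`, `zeroAbelianVariety_dim`, `not_exists_multiplier_of_dim_eq_zero`,
   `dim_ne_zero_of_multiplier`;
§2 `WithoutForallDvd`, `ExistsForm`, `WithoutNeZero`, `WithoutDim`, `WeilRestrictionFamily`, the
   `of_without…` sanity implications (each variant ⟹ U) and the `_false_without_` / `not_` theorems;
§3 `-- Targets`: none yet (payload.targets empty at cycle 1);
§4 HERE: `UniformForm` (drop the height; OPEN, implies U: `of_uniformForm`), `MultiplierForm` (least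
   multiplier bound; FALSE on paper by the MRS composite gluing, implies U: `of_multiplierForm`).
-/

noncomputable section

open CategoryTheory
open Literature.AlgebraicGeometry.Motives
open Summit.ABC.ABC.Theses.IsogenyGlueCongruence
open Summit.ABC.ABC.Theorems.EllipticGluingPrimeBound.Negative

-- `Summit.<Summit>.<Sub>` is the mandated summit-side namespace (CONVENTIONS §2); for the
-- single-conjunct summit `ABC` the two coincide, so the duplicate `ABC.ABC` is deliberate.
set_option linter.dupNamespace false

namespace Summit.ABC.ABC.Cruxes.EllipticGluingPrimeBound.Disproof

/-! ## §0–§2 Landed content, re-checked (this file breaks if the tree copy drifts) -/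

example : EllipticGluingPrimeBound ↔ ∃ κ C : ℝ, 0 ≤ κ ∧ Bound κ C := iff_exists_bound
example : EllipticGluingPrimeBound ↔ ∃ κ C : ℝ, 1 ≤ κ ∧ 0 ≤ C ∧ Bound κ C := iff_normalised
example (L₀ : ℕ) : EllipticGluingPrimeBound ↔ ∃ κ C : ℝ, 0 ≤ κ ∧ BoundAbove L₀ κ C :=
  iff_boundAbove L₀
example : zeroAbelianVariety.dim = 0 := zeroAbelianVariety_dim
example {W : WeierstrassCurve ℚ} [W.IsElliptic] {E : AbelianVariety.{0} ℚ}
    (e : E.geomPoints ≃+ W.geomPoints) {n : ℤ} : n • 𝟙 E = 0 ↔ n = 0 := zsmul_id_eq_zero_iff e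
example (E : AbelianVariety.{0} ℚ) {ℓ : ℕ} (hℓ : ℓ.Prime) :
    ¬ ∀ (α : E ⟶ E) (β : E ⟶ E) (n : ℤ), α ≫ β = n • 𝟙 E → (ℓ : ℤ) ∣ n := not_forall_dvd_self E hℓ
example : ¬ WithoutNeZero := ellipticGluingPrimeBound_false_without_neZero
example : ¬ WithoutForallDvd := ellipticGluingPrimeBound_false_without_forallDvd
example : ¬ ExistsForm := not_existsForm
example (H : WeilRestrictionFamily) : ¬ WithoutDim := not_withoutDim_of_weilRestrictionFamily H
example (H : WeilRestrictionFamily) {κ C : ℝ} (h : Bound κ C) : 1 ≤ κ :=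
  one_le_kappa_of_weilRestrictionFamily H h
example (h : WithoutNeZero) : EllipticGluingPrimeBound := of_withoutNeZero h
example (h : WithoutForallDvd) : EllipticGluingPrimeBound := of_withoutForallDvd h
example (h : WithoutDim) : EllipticGluingPrimeBound := of_withoutDim h

/-! ## §3 Targets (lead's stuck stubs) — none registered at cycle 1 -/

/-! ## §4 Neighbourhood map: the two remaining natural variants and their relation to U -/

/-- The UNIFORM form: the height of `W` dropped, `ℓ ≤ C · (dim B) ^ κ`. STATUS: OPEN. For bounded
`dim B` it is the uniform torsion-sharing conjecture (d = 1: uniform Frey–Mazur, record `ℓ = 17`,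
Cremona–Freitas 2021/Fisher); no counterexample known; all calibration families F1–F9 of the module
docstring satisfy it with `κ = 1` (`ℓ ≤ 2 dim B + 1`) except possibly sporadic pairs. It IMPLIES U
(`of_uniformForm`), so refuting U refutes it too; the converse is not expected to be provable. -/
def UniformForm : Prop :=
  ∃ κ C : ℝ, 0 ≤ κ ∧ ∀ (W : WeierstrassCurve ℚ) [W.IsElliptic] (E B : AbelianVariety.{0} ℚ)
    (e : E.geomPoints ≃+ W.geomPoints),
    (∀ (σ : Field.absoluteGaloisGroup ℚ) (P : E.geomPoints), e (σ • P) = σ • e P) →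
    ∀ ℓ : ℕ, ℓ.Prime →
      (∃ (α : E ⟶ B) (β : B ⟶ E) (n : ℤ), n ≠ 0 ∧ α ≫ β = n • 𝟙 E) →
      (∀ (α : E ⟶ B) (β : B ⟶ E) (n : ℤ), α ≫ β = n • 𝟙 E → (ℓ : ℤ) ∣ n) →
        (ℓ : ℝ) ≤ C * (B.dim : ℝ) ^ κ

/-- **The uniform form implies the crux** (`max 1 h ≥ 1`, `κ ≥ 0`, `C ↦ max C 0`). [folklore] -/
theorem of_uniformForm (h : UniformForm) : EllipticGluingPrimeBound := by
  obtain ⟨κ, C, hκ, h⟩ := h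
  refine ⟨κ, max C 0, hκ, fun W _ E B e he ℓ hℓ hex hall ↦ (h W E B e he ℓ hℓ hex hall).trans ?_⟩
  have hd : (0 : ℝ) ≤ B.dim := Nat.cast_nonneg _
  have hm : (1 : ℝ) ≤ max 1 W.stableFaltingsHeight := le_max_left _ _
  have hle : (B.dim : ℝ) ≤ (B.dim : ℝ) * max 1 W.stableFaltingsHeight :=
    le_mul_of_one_le_right hd hm
  calc C * (B.dim : ℝ) ^ κ ≤ max C 0 * (B.dim : ℝ) ^ κ :=
        mul_le_mul_of_nonneg_right (le_max_left _ _) (Real.rpow_nonneg hd κ)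
    _ ≤ max C 0 * ((B.dim : ℝ) * max 1 W.stableFaltingsHeight) ^ κ :=
        mul_le_mul_of_nonneg_left (Real.rpow_le_rpow hd hle hκ) (le_max_right _ _)

/-- The MULTIPLIER form: some POSITIVE `E`-multiplier of `B` is itself `≤ C (dim B · max 1 h)^κ`.
STATUS: FALSE on paper — the composite cyclotomic gluing `B = M ⊗ E`, `M ⊂ ℤ ⊕ ⊕ᵢ ℤ[ζ_{pᵢ}]` glued
along the augmentations (Mazur–Rubin–Silverberg 2007 twists; planner rev 4, re-derived in the module
docstring F2: `M^G = (∏ pᵢ)ℤ`, `Hom_G(M, ℤ) = ℤ·pr₁`), has least positive multiplier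
`∏ pᵢ = exp((1+o(1))√(dim B · log dim B))`, super-polynomial in `dim B` at fixed `h`. Not refutable in
the tree (no Artin twists of abelian schemes). It IMPLIES U (`of_multiplierForm`): this is exactly why
the crux is stated prime-by-prime. -/
def MultiplierForm : Prop :=
  ∃ κ C : ℝ, 0 ≤ κ ∧ ∀ (W : WeierstrassCurve ℚ) [W.IsElliptic] (E B : AbelianVariety.{0} ℚ)
    (e : E.geomPoints ≃+ W.geomPoints),
    (∀ (σ : Field.absoluteGaloisGroup ℚ) (P : E.geomPoints), e (σ • P) = σ • e P) →
      (∃ (α : E ⟶ B) (β : B ⟶ E) (n : ℤ), n ≠ 0 ∧ α ≫ β = n • 𝟙 E) →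
        ∃ (α : E ⟶ B) (β : B ⟶ E) (n : ℤ), 0 < n ∧ α ≫ β = n • 𝟙 E ∧
          (n : ℝ) ≤ C * ((B.dim : ℝ) * max 1 W.stableFaltingsHeight) ^ κ

/-- **The multiplier form implies the crux**: a prime dividing every multiplier divides the small
positive one, hence is at most as large. [folklore] -/
theorem of_multiplierForm (h : MultiplierForm) : EllipticGluingPrimeBound := by
  obtain ⟨κ, C, hκ, h⟩ := h
  refine ⟨κ, C, hκ, fun W _ E B e he ℓ hℓ hex hall ↦ ?_⟩
  obtain ⟨α, β, n, hn, hc, hle⟩ := h W E B e he hex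
  have hdvd : (ℓ : ℤ) ∣ n := hall α β n hc
  have hℓn : (ℓ : ℤ) ≤ n := Int.le_of_dvd hn hdvd
  have : (ℓ : ℝ) ≤ n := by exact_mod_cast hℓn
  exact this.trans hle

end Summit.ABC.ABC.Cruxes.EllipticGluingPrimeBound.Disproof

end
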